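import Literature.AnabelianGeometry.SemiGraphs.TemperedCentralizerEscapeDichotomy
import Literature.AnabelianGeometry.SemiGraphs.TemperedEdgeLikeCommensurator
import Literature.AnabelianGeometry.SemiGraphs.TemperedEdgeLikeIsInfVerticialHolds
import HarnessLib

/-!
# [SemiAnbd] Thm 3.7 (ii)–(iv) at every LOCALLY FINITE countable `𝒢`: the triple-conjugate criterion,
# normalisers of compact subgroups, and «edge-like subgroups are commensurably terminal» WITHOUT (iii)

Mochizuki, *Semi-graphs of anabelioids*, Publ. RIMS **42** (2006), §3, Theorem 3.7 (ii)–(iv) pp. 40–41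
("verticial subgroups … arise from distinct parametrization data are distinct"; "the nontrivial
intersections of two distinct maximal compact subgroups … are precisely the edge-like subgroups") and §5
p. 65 (commensurators of the decomposition groups) [cite: MochizukiSemiAnbd2006, Thm 3.7(iv) p.41].

PROOF-ONLY (abc-iut cell, block F, seat abc-iut-f-172 gen 4; third file of the lineage
`TemperedCompactCentralizerInVerticial` → `TemperedCentralizerEscapeDichotomy`; no definition, no new named
fact).  The one-level tree argument of the lineage (`VerticialLevelData.mem_of_adjacent_translates`) needs
only a nontrivial compact subgroup `K` fixing the three systems `y`, `g·y`, `g²·y` of a verticial `H`; the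
weakest algebraic way to guarantee this is `K ≤ H ∩ gHg⁻¹ ∩ g²Hg⁻²`.  Hence, at every LOCALLY FINITE graph
of anabelioids satisfying the hypotheses of Thm 3.7 and EVERY chart (adjacency clause of (FIX∞) =
abc-iut-w6-d062's `hadj_temperedPiChart_of_isLocallyFinite`, transported):

* `VerticialLevelData.mem_of_le_conj_conj` (abstract, binder `hadj` at `K`) and
  **`mem_verticial_of_le_conj_conj_of_isLocallyFinite`** — THE TRIPLE-CONJUGATE CRITERION: if a compact
  `K ≠ 1` lies in `H`, in `gHg⁻¹` and in `g²Hg⁻²` (`H` verticial), then `g ∈ H`;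
  `mem_verticial_of_inf_conj_conj_ne_bot_of_isLocallyFinite` — `H ⊓ gHg⁻¹ ⊓ g²Hg⁻² ≠ 1 ⇒ g ∈ H`.
  (The pair version `H ⊓ gHg⁻¹ ≠ 1 ⇒ g ∈ H` is FALSE: translations along a loop.)
* **`normalizer_le_verticial_of_isLocallyFinite`** — the NORMALISER of every nontrivial compact `C ≤ H`
  lies in `H` (sharpens the lineage's centraliser theorem).
* **`commensurator_le_verticial_of_mem_edgeLikeSubgroups_of_isLocallyFinite`** — the commensurator of an
  edge-like subgroup `L` lies in every verticial `H ⊇ L` (`K := L ∩ gLg⁻¹ ∩ g²Lg⁻²`, of finite index in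
  the infinite compact `L`); with abc-iut-f-173's unconditional F-1703 `edgeLikeIsInfVerticialAt_holds`
  (`L = H₁ ⊓ H₂`): **`commensurator_eq_of_mem_edgeLikeSubgroups_of_isLocallyFinite` — EDGE-LIKE SUBGROUPS
  ARE COMMENSURABLY TERMINAL, `C(L) = L`**, and `eq_of_commensurable_of_mem_edgeLikeSubgroups_of_isLocallyFinite`
  — commensurable edge-like subgroups are equal.  These are the statements of abc-iut-w4-d053/L3's
  `TemperedEdgeLikeCommensurator.lean`, there modulo `CompactInVerticialAt 𝒢` (Thm 3.7 (iii) AT `𝒢`, whose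
  first sentence FAILS at such graphs — `not_compactInVerticial`); here hypothesis-free beyond Thm 3.7's
  hypotheses, `IsGraph` and local finiteness (𝒢_θ included).

Honest framing: OUR typed tempered fundamental groups; vertices of infinite valence excluded; nothing here
bears on [IUTchIII] Cor. 3.12; typed ≠ proved elsewhere.
-/

namespace Literature.AnabelianGeometry.SemiGraphs

namespace ProfiniteSemiGraph

open CategoryTheory Topology
open scoped Pointwise

universe v u

namespace VerticialLevelData

variable {𝒢 : ProfiniteSemiGraph.{u}} {c : TemperedPiChart 𝒢} (D : VerticialLevelData.{v} 𝒢 c)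

/-- The action of a product on a vertex of `𝒢_{∞,j}`. [cite: MochizukiSemiAnbd2006, Thm 3.7(iii) p.41] -/
private theorem act_mul_vertexMap'' (j : D.J) (a b : c.G) (y : (D.tree j).Vertex) :
    (D.act j (a * b)).hom.vertexMap y = (D.act j a).hom.vertexMap ((D.act j b).hom.vertexMap y) := by
  rw [map_mul]; rfl

/-- A conjugate `g h g⁻¹` of an element `h` fixing `x` fixes `g·x`. [cite: MochizukiSemiAnbd2006, Thm 3.7(iii) p.41] -/
private theorem conj_fix (j : D.J) (g h : c.G) (x : (D.tree j).Vertex)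
    (hx : (D.act j h).hom.vertexMap x = x) :
    (D.act j (g * h * g⁻¹)).hom.vertexMap ((D.act j g).hom.vertexMap x) = (D.act j g).hom.vertexMap x := by
  rw [← D.act_mul_vertexMap'', show g * h * g⁻¹ * g = g * h by group, D.act_mul_vertexMap'', hx]

/-- **The triple-conjugate criterion over level data** ([SemiAnbd] Thm 3.7 (ii)–(iv) pp. 40–41): let `H` be
verticial and `K` a subgroup enjoying the adjacency clause `hadj` of (FIX∞) (any two compatible `K`-fixed
vertex systems that differ at a level are the two ends of an edge there).  If `K ≤ H`, `K ≤ gHg⁻¹` and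
`K ≤ g²Hg⁻²`, then `g ∈ H`: `K` fixes the system `y` of `H` and its translates `g·y`, `g²·y`, which are
therefore adjacent to `y`, and `mem_of_adjacent_translates` applies.
[cite: MochizukiSemiAnbd2006, Thm 3.7(iv) p.41] -/
theorem mem_of_le_conj_conj (hVD : VerticialDistinct.{u}) (h𝒢 : 𝒢.Thm37Hypotheses)
    {v : 𝒢.graph.Vertex} {H : Subgroup c.G} (hH : H ∈ verticialSubgroups c v) (K : Subgroup c.G)
    (hadj : ∀ x x' : ∀ j, (D.tree j).Vertex,
      (∀ ⦃i j : D.J⦄ (h : i ≤ j), (D.trans h).vertexMap (x j) = x i) →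
      (∀ ⦃i j : D.J⦄ (h : i ≤ j), (D.trans h).vertexMap (x' j) = x' i) →
      (∀ k ∈ K, ∀ j, (D.act j k).hom.vertexMap (x j) = x j) →
      (∀ k ∈ K, ∀ j, (D.act j k).hom.vertexMap (x' j) = x' j) →
      ∀ j, x j ≠ x' j → ∃ (e : (D.tree j).Edge) (b b' : (D.tree j).Branch), b ≠ b' ∧
        (D.tree j).edgeOf b = e ∧ (D.tree j).edgeOf b' = e ∧ (D.tree j).abuts b = some (x j) ∧
        (D.tree j).abuts b' = some (x' j) ∧ ∀ k ∈ K, (D.act j k).hom.edgeMap e = e)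
    (hKH : K ≤ H) (g : c.G) (hKg : ∀ k ∈ K, ∃ h ∈ H, g * h * g⁻¹ = k)
    (hKg₂ : ∀ k ∈ K, ∃ h ∈ H, (g * g) * h * (g * g)⁻¹ = k) : g ∈ H := by
  obtain ⟨y, hyc, hyH⟩ := D.fix v H hH
  -- the three systems `y`, `g·y`, `g²·y` are compatible and `K`-fixed
  have hyK : ∀ k ∈ K, ∀ j, (D.act j k).hom.vertexMap (y j) = y j := fun k hk j => hyH k (hKH hk) j
  have hy₁c := D.translate_compat' g hyc
  have hy₂c := D.translate_compat' g hy₁c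
  have hy₁K : ∀ k ∈ K, ∀ j, (D.act j k).hom.vertexMap ((D.act j g).hom.vertexMap (y j)) =
      (D.act j g).hom.vertexMap (y j) := by
    intro k hk j
    obtain ⟨h, hh, rfl⟩ := hKg k hk
    exact D.conj_fix j g h (y j) (hyH h hh j)
  have hy₂K : ∀ k ∈ K, ∀ j,
      (D.act j k).hom.vertexMap ((D.act j g).hom.vertexMap ((D.act j g).hom.vertexMap (y j))) =
        (D.act j g).hom.vertexMap ((D.act j g).hom.vertexMap (y j)) := by
    intro k hk j
    obtain ⟨h, hh, rfl⟩ := hKg₂ k hk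
    have h2 : (D.act j g).hom.vertexMap ((D.act j g).hom.vertexMap (y j)) =
        (D.act j (g * g)).hom.vertexMap (y j) := (D.act_mul_vertexMap'' j g g (y j)).symm
    rw [h2]
    exact D.conj_fix j (g * g) h (y j) (hyH h hh j)
  refine D.mem_of_adjacent_translates hVD h𝒢 hH y hyc hyH g ?_ ?_
  · intro j hne
    obtain ⟨e, b, b', -, hbe, hb'e, hb, hb', -⟩ :=
      hadj y (fun j => (D.act j g).hom.vertexMap (y j)) hyc hy₁c hyK hy₁K j (Ne.symm hne)
    exact ⟨e, b, b', hbe, hb'e, hb, hb'⟩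
  · intro j hne
    obtain ⟨e, b, b', -, hbe, hb'e, hb, hb', -⟩ :=
      hadj y (fun j => (D.act j g).hom.vertexMap ((D.act j g).hom.vertexMap (y j))) hyc hy₂c hyK hy₂K j
        (Ne.symm hne)
    exact ⟨e, b, b', hbe, hb'e, hb, hb'⟩

end VerticialLevelData

/-! ### The triple-conjugate criterion at every locally finite countable `𝒢` -/

variable (𝒢 : ProfiniteSemiGraph.{u})

/-- **TRIPLE-CONJUGATE CRITERION — every locally finite countable `𝒢` satisfying the hypotheses of [SemiAnbd]
Thm 3.7, every chart**: if a compact subgroup `K ≠ 1` of `π₁^temp(𝒢)` lies in a verticial subgroup `H`, in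
`gHg⁻¹` and in `g²Hg⁻²`, then `g ∈ H` (so `gHg⁻¹ = H`).  The adjacency clause of (FIX∞) at `K` is
abc-iut-w6-d062's `hadj_temperedPiChart_of_isLocallyFinite`, transported along `TemperedPiChart.exists_compatIso`
/ `VerticialLevelData.transport` / `hadj_transport`; neither sentence of Thm 3.7 (iii) is used.
[cite: MochizukiSemiAnbd2006, Thm 3.7(iv) p.41] -/
theorem mem_verticial_of_le_conj_conj_of_isLocallyFinite (h37 : 𝒢.Thm37Hypotheses)
    (hlf : 𝒢.graph.IsLocallyFinite) (c : TemperedPiChart 𝒢) {v : 𝒢.graph.Vertex} {H : Subgroup c.G}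
    (hH : H ∈ verticialSubgroups c v) (K : Subgroup c.G) (hKc : IsCompact (K : Set c.G)) (hK : K ≠ ⊥)
    (hKH : K ≤ H) (g : c.G) (hKg : ∀ k ∈ K, ∃ h ∈ H, g * h * g⁻¹ = k)
    (hKg₂ : ∀ k ∈ K, ∃ h ∈ H, (g * g) * h * (g * g)⁻¹ = k) : g ∈ H := by
  obtain ⟨φ, ψ, hψφ, hφψ, hφ, hψ⟩ :=
    TemperedPiChart.exists_compatIso (𝒢.temperedPiChart h37.toProp36Hypotheses) c
  let D₀ := verticialLevelData_temperedPiChart (h36 := h37.toProp36Hypotheses)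
  let D : VerticialLevelData.{0} 𝒢 c := D₀.transport φ ψ hψφ hφψ
    (fun v H => mem_verticialSubgroups_iff_map φ hφ ψ hφψ hψ H)
    (fun e L => mem_edgeLikeSubgroups_iff_map φ hφ ψ hφψ hψ L)
  exact D.mem_of_le_conj_conj verticialDistinct_holds h37 hH K
    (D₀.hadj_transport φ ψ hψφ hφψ _ _
      (fun C' hC'c hC' x x' hx hx' hfx hfx' j hne' =>
        𝒢.hadj_temperedPiChart_of_isLocallyFinite h37 hlf C' hC'c hC' x x' hx hx' hfx hfx' j hne') K hKc hK)
    hKH g hKg hKg₂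

/-- Conjugation by `g` maps compact sets to compact sets. [cite: MochizukiSemiAnbd2006, Thm 3.7(i) p.40] -/
private theorem isCompact_map_conj {G : Type u} [Group G] [TopologicalSpace G] [IsTopologicalGroup G]
    {H : Subgroup G} (hH : IsCompact (H : Set G)) (g : G) :
    IsCompact ((H.map (MulAut.conj g).toMonoidHom : Subgroup G) : Set G) := by
  rw [Subgroup.coe_map]
  exact hH.image (IsTopologicalGroup.continuous_conj g)

/-- **`H ⊓ gHg⁻¹ ⊓ g²Hg⁻² ≠ 1 ⇒ g ∈ H`** for a verticial `H`, at every locally finite countable `𝒢` satisfying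
the hypotheses of Thm 3.7, every chart (the intersection is compact: verticial subgroups are compact).  The
pair version `H ⊓ gHg⁻¹ ≠ 1 ⇒ g ∈ H` is false in general (a translation along a loop of `𝔾` moves the
vertex to an adjacent one, and `H ⊓ gHg⁻¹` is then edge-like). [cite: MochizukiSemiAnbd2006, Thm 3.7(iv) p.41] -/
theorem mem_verticial_of_inf_conj_conj_ne_bot_of_isLocallyFinite (h37 : 𝒢.Thm37Hypotheses)
    (hlf : 𝒢.graph.IsLocallyFinite) (c : TemperedPiChart 𝒢) {v : 𝒢.graph.Vertex} {H : Subgroup c.G}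
    (hH : H ∈ verticialSubgroups c v) (g : c.G)
    (hne : H ⊓ H.map (MulAut.conj g).toMonoidHom ⊓ H.map (MulAut.conj (g * g)).toMonoidHom ≠ ⊥) :
    g ∈ H := by
  haveI := TemperedPiChart.t2Space c
  have hHc : IsCompact (H : Set c.G) := isCompact_of_mem_verticialSubgroups c hH
  set K := H ⊓ H.map (MulAut.conj g).toMonoidHom ⊓ H.map (MulAut.conj (g * g)).toMonoidHom with hKdef
  have hKc : IsCompact (K : Set c.G) := by
    rw [hKdef, Subgroup.coe_inf, Subgroup.coe_inf]
    exact (hHc.inter_right (isCompact_map_conj hHc g).isClosed).inter_right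
      (isCompact_map_conj hHc (g * g)).isClosed
  refine 𝒢.mem_verticial_of_le_conj_conj_of_isLocallyFinite h37 hlf c hH K hKc hne
    (inf_le_left.trans inf_le_left) g (fun k hk => ?_) (fun k hk => ?_)
  · obtain ⟨h, hh, hhk⟩ := (inf_le_left.trans inf_le_right : K ≤ _) hk
    exact ⟨h, hh, hhk⟩
  · obtain ⟨h, hh, hhk⟩ := (inf_le_right : K ≤ _) hk
    exact ⟨h, hh, hhk⟩

/-! ### Normalisers of nontrivial compact subgroups of a verticial subgroup -/

/-- **The normaliser of a nontrivial compact subgroup `C` of a verticial subgroup `H` lies in `H`**, at every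
locally finite countable `𝒢` satisfying the hypotheses of Thm 3.7, every chart (`C ≤ H`, `gCg⁻¹ = C ≤ gHg⁻¹`,
`g²Cg⁻² = C ≤ g²Hg⁻²`, and the triple-conjugate criterion at `K := C`).  Sharpens the lineage's
`centralizer_le_verticial_of_isLocallyFinite`. [cite: MochizukiSemiAnbd2006, Thm 3.7(iv) p.41] -/
theorem normalizer_le_verticial_of_isLocallyFinite (h37 : 𝒢.Thm37Hypotheses) (hlf : 𝒢.graph.IsLocallyFinite)
    (c : TemperedPiChart 𝒢) (C : Subgroup c.G) (hCc : IsCompact (C : Set c.G)) (hC : C ≠ ⊥)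
    {v : 𝒢.graph.Vertex} {H : Subgroup c.G} (hH : H ∈ verticialSubgroups c v) (hCH : C ≤ H) :
    Subgroup.normalizer (C : Set c.G) ≤ H := by
  intro g hg
  -- `x ∈ C ⇒ a⁻¹ x a ∈ C` for `a` in the normaliser
  have key : ∀ {a : c.G}, a ∈ Subgroup.normalizer (C : Set c.G) → ∀ x ∈ C, a⁻¹ * x * a ∈ C := by
    intro a ha x hx
    have h := (Subgroup.mem_normalizer_iff.mp ((Subgroup.normalizer (C : Set c.G)).inv_mem ha) x).mp hx
    simpa using h
  refine 𝒢.mem_verticial_of_le_conj_conj_of_isLocallyFinite h37 hlf c hH C hCc hC hCH g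
    (fun k hk => ⟨g⁻¹ * k * g, hCH (key hg k hk), by group⟩)
    (fun k hk => ⟨(g * g)⁻¹ * k * (g * g),
      hCH (key ((Subgroup.normalizer (C : Set c.G)).mul_mem hg hg) k hk), by group⟩)

/-! ### Edge-like subgroups are commensurably terminal at locally finite graphs — no Thm 3.7 (iii) -/

variable {𝒢}

/-- An element of `g·S` (conjugation action) is `g s g⁻¹` for some `s ∈ S`. [cite: MochizukiSemiAnbd2006, §5 p.65] -/
private theorem exists_conj_eq_of_mem_smul {G : Type u} [Group G] {S : Subgroup G} {g k : G}
    (hk : k ∈ ConjAct.toConjAct g • S) : ∃ s ∈ S, g * s * g⁻¹ = k := by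
  rw [Subgroup.mem_smul_pointwise_iff_exists] at hk
  obtain ⟨s, hs, rfl⟩ := hk
  exact ⟨s, hs, by simp [ConjAct.smul_def]⟩

/-- `g·S` (conjugation action) is compact when `S` is. [cite: MochizukiSemiAnbd2006, Thm 3.7(i) p.40] -/
private theorem isCompact_smul {G : Type u} [Group G] [TopologicalSpace G] [IsTopologicalGroup G]
    {S : Subgroup G} (hS : IsCompact (S : Set G)) (g : G) :
    IsCompact ((ConjAct.toConjAct g • S : Subgroup G) : Set G) := by
  have hset : ((ConjAct.toConjAct g • S : Subgroup G) : Set G) = (fun x => g * x * g⁻¹) '' (S : Set G) := by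
    ext k
    simp only [SetLike.mem_coe, Set.mem_image]
    constructor
    · intro hk
      obtain ⟨s, hs, hsk⟩ := exists_conj_eq_of_mem_smul hk
      exact ⟨s, hs, hsk⟩
    · rintro ⟨s, hs, rfl⟩
      exact (Subgroup.mem_smul_pointwise_iff_exists _ _ _).mpr ⟨s, hs, by simp [ConjAct.smul_def]⟩
  rw [hset]
  exact hS.image (IsTopologicalGroup.continuous_conj g)

/-- **The commensurator of an edge-like subgroup lies in each of its verticial hosts**, at every locally finite
countable `𝒢` satisfying the hypotheses of Thm 3.7, every chart: for `L` edge-like, `H ⊇ L` verticial and `g`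
commensurating `L`, the subgroup `K := L ∩ gLg⁻¹ ∩ g²Lg⁻²` has finite index in the infinite compact `L`
(`g²` commensurates `L` too), so it is a nontrivial compact subgroup of `H ∩ gHg⁻¹ ∩ g²Hg⁻²` and the
triple-conjugate criterion gives `g ∈ H`. [cite: MochizukiSemiAnbd2006, Thm 3.7(iv) p.41] -/
theorem commensurator_le_verticial_of_mem_edgeLikeSubgroups_of_isLocallyFinite (h37 : 𝒢.Thm37Hypotheses)
    (hlf : 𝒢.graph.IsLocallyFinite) (c : TemperedPiChart 𝒢) {e : 𝒢.graph.Edge} {L : Subgroup c.G}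
    (hL : L ∈ edgeLikeSubgroups c e) {v : 𝒢.graph.Vertex} {H : Subgroup c.G}
    (hH : H ∈ verticialSubgroups c v) (hLH : L ≤ H) :
    Subgroup.Commensurable.commensurator L ≤ H := by
  classical
  haveI := TemperedPiChart.t2Space c
  intro g hg
  have hg₂ : g * g ∈ Subgroup.Commensurable.commensurator L := Subgroup.mul_mem _ hg hg
  have hcomm₁ : Subgroup.Commensurable (ConjAct.toConjAct g • L) L :=
    (Subgroup.Commensurable.commensurator_mem_iff L g).mp hg
  have hcomm₂ : Subgroup.Commensurable (ConjAct.toConjAct (g * g) • L) L :=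
    (Subgroup.Commensurable.commensurator_mem_iff L (g * g)).mp hg₂
  set A : Subgroup c.G := ConjAct.toConjAct g • L with hAdef
  set B : Subgroup c.G := ConjAct.toConjAct (g * g) • L with hBdef
  set K : Subgroup c.G := A ⊓ B ⊓ L with hKdef
  -- `K` is compact
  have hLc : IsCompact (L : Set c.G) := isCompact_of_mem_edgeLikeSubgroups c hL
  have hKc : IsCompact (K : Set c.G) := by
    rw [hKdef, Subgroup.coe_inf, Subgroup.coe_inf]
    exact ((isCompact_smul hLc g).inter_right (isCompact_smul hLc (g * g)).isClosed).inter_right hLc.isClosed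
  -- `K` has finite index in the infinite `L`, hence is nontrivial
  haveI hLinf := infinite_of_mem_edgeLikeSubgroups verticialInjective_holds h37 c hL
  have hidx : (A ⊓ B).relIndex L ≠ 0 := Subgroup.relIndex_inf_ne_zero hcomm₁.1 hcomm₂.1
  have hK : K ≠ ⊥ := by
    intro hbot
    have hdis : Disjoint (A ⊓ B) L := by
      rw [disjoint_iff, ← hKdef]
      exact hbot
    have h0 : (A ⊓ B).relIndex L = 0 := by
      rw [Subgroup.relIndex, Subgroup.subgroupOf_eq_bot.mpr hdis, Subgroup.index_bot]
      exact Nat.card_eq_zero_of_infinite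
    exact hidx h0
  -- the triple-conjugate criterion at `K`
  refine 𝒢.mem_verticial_of_le_conj_conj_of_isLocallyFinite h37 hlf c hH K hKc hK
    (inf_le_right.trans hLH) g (fun k hk => ?_) (fun k hk => ?_)
  · obtain ⟨s, hs, hsk⟩ := exists_conj_eq_of_mem_smul ((inf_le_left.trans inf_le_left : K ≤ A) hk)
    exact ⟨s, hLH hs, hsk⟩
  · obtain ⟨s, hs, hsk⟩ := exists_conj_eq_of_mem_smul ((inf_le_left.trans inf_le_right : K ≤ B) hk)
    exact ⟨s, hLH hs, hsk⟩

/-- **EDGE-LIKE SUBGROUPS ARE COMMENSURABLY TERMINAL, `C(L) = L`, at every locally finite countable graph of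
anabelioids satisfying the hypotheses of [SemiAnbd] Thm 3.7 — every chart, WITHOUT Thm 3.7 (iii)**
(print: Thm 3.7 (iv) p. 41 with §5 p. 65; the tree's `commensurator_eq_of_mem_edgeLikeSubgroupsAt` binds
`CompactInVerticialAt 𝒢`, whose first sentence fails at such graphs).  Route: every edge of a graph is closed and
`L ≠ 1` (edge groups are infinite), so abc-iut-f-173's unconditional F-1703 `edgeLikeIsInfVerticialAt_holds` writes
`L = H₁ ⊓ H₂` for two verticial hosts; the commensurator lies in both.
[cite: MochizukiSemiAnbd2006, Thm 3.7(iv) p.41] -/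
theorem commensurator_eq_of_mem_edgeLikeSubgroups_of_isLocallyFinite (h37 : 𝒢.Thm37Hypotheses)
    (hG : 𝒢.graph.IsGraph) (hlf : 𝒢.graph.IsLocallyFinite) (c : TemperedPiChart 𝒢) {e : 𝒢.graph.Edge}
    {L : Subgroup c.G} (hL : L ∈ edgeLikeSubgroups c e) :
    Subgroup.Commensurable.commensurator L = L := by
  classical
  -- `e` is closed and `L ≠ 1`
  obtain ⟨b₁, b₂, hb12, hb₁e, hb₂e, -⟩ := 𝒢.graph.two_branches e
  obtain ⟨w₁, hw₁⟩ := Option.isSome_iff_exists.mp (hG.abuts_isSome b₁)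
  obtain ⟨w₂, hw₂⟩ := Option.isSome_iff_exists.mp (hG.abuts_isSome b₂)
  have hclosed : 𝒢.graph.IsClosedEdge e :=
    hb₁e ▸ SemiGraph.isClosedEdge_of_abuts hb12 rfl (hb₂e.trans hb₁e.symm) hw₁ hw₂
  haveI hLinf := infinite_of_mem_edgeLikeSubgroups verticialInjective_holds h37 c hL
  have hLne : L ≠ ⊥ := by
    intro hb
    rw [hb] at hLinf
    exact not_finite (⊥ : Subgroup c.G)
  -- F-1703: `L = H₁ ⊓ H₂`
  obtain ⟨v₁, v₂, H₁, H₂, hH₁, hH₂, -, hLeq⟩ := edgeLikeIsInfVerticialAt_holds 𝒢 h37 c e hclosed L hL hLne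
  refine le_antisymm (fun g hg => ?_) (le_commensurator_self L)
  have h1 : g ∈ H₁ := commensurator_le_verticial_of_mem_edgeLikeSubgroups_of_isLocallyFinite h37 hlf c hL hH₁
    (hLeq ▸ inf_le_left) hg
  have h2 : g ∈ H₂ := commensurator_le_verticial_of_mem_edgeLikeSubgroups_of_isLocallyFinite h37 hlf c hL hH₂
    (hLeq ▸ inf_le_right) hg
  rw [hLeq]
  exact ⟨h1, h2⟩

/-- **Commensurable edge-like subgroups are EQUAL, at every locally finite countable graph of anabelioids
satisfying the hypotheses of Thm 3.7 — every chart, without Thm 3.7 (iii)** (the statement of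
`eq_of_commensurable_of_mem_edgeLikeSubgroupsAt`, there modulo `CompactInVerticialAt 𝒢`): commensurable
subgroups have the same commensurator, and edge-like subgroups are their own commensurators.
[cite: MochizukiSemiAnbd2006, Thm 3.7(iv) p.41] -/
theorem eq_of_commensurable_of_mem_edgeLikeSubgroups_of_isLocallyFinite (h37 : 𝒢.Thm37Hypotheses)
    (hG : 𝒢.graph.IsGraph) (hlf : 𝒢.graph.IsLocallyFinite) (c : TemperedPiChart 𝒢) {e e' : 𝒢.graph.Edge}
    {L L' : Subgroup c.G} (hL : L ∈ edgeLikeSubgroups c e) (hL' : L' ∈ edgeLikeSubgroups c e')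
    (hc : Subgroup.Commensurable L L') : L = L' := by
  rw [← commensurator_eq_of_mem_edgeLikeSubgroups_of_isLocallyFinite h37 hG hlf c hL,
    ← commensurator_eq_of_mem_edgeLikeSubgroups_of_isLocallyFinite h37 hG hlf c hL', hc.eq]

/-- **A commensurating element normalises an edge-like subgroup**, at every locally finite Thm-3.7 graph
(the statement of `smul_eq_self_of_mem_commensurator_of_mem_edgeLikeSubgroupsAt`, without Thm 3.7 (iii)).
[cite: MochizukiSemiAnbd2006, Thm 3.7(iv) p.41] -/
theorem smul_eq_self_of_mem_commensurator_of_mem_edgeLikeSubgroups_of_isLocallyFinite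
    (h37 : 𝒢.Thm37Hypotheses) (hG : 𝒢.graph.IsGraph) (hlf : 𝒢.graph.IsLocallyFinite) (c : TemperedPiChart 𝒢)
    {e : 𝒢.graph.Edge} {L : Subgroup c.G} (hL : L ∈ edgeLikeSubgroups c e) {g : c.G}
    (hg : g ∈ Subgroup.Commensurable.commensurator L) : ConjAct.toConjAct g • L = L := by
  rw [Subgroup.Commensurable.commensurator_mem_iff] at hg
  exact eq_of_commensurable_of_mem_edgeLikeSubgroups_of_isLocallyFinite h37 hG hlf c
    (conj_mem_edgeLikeSubgroups' c hL g) hL hg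

end ProfiniteSemiGraph

end Literature.AnabelianGeometry.SemiGraphs
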